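import Literature.NumberTheory.Automorphic.ArchTorusOrbitalContinuity   -- ★ p839464 (V2)-glob FILE B (F0P3a-p06): global joint properness; ⇒ FILE A p839258, `archPiEquivCM_archDiagTorus`
import HarnessLib

/-!
# Fubini for the torus orbital function of `G′_∞ = U(diag α)(L⁺ ⊗ ℝ) ≃ Π_w G_w`: the global torus function is the per-place torus function of the
# partial orbital integral over the other places (ROAD-Sd (V7); Borel–Jacquet §4.1, Rogawski 1990 §8.2–8.3)

Topic `NumberTheory/Automorphic`; namespace `Literature.NumberTheory.Automorphic.UnitaryGroup`.  THEOREMS ONLY (no `def`, no instance, no notation, no axiom,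
no `sorry`).  Cell `pub/hodgecm-mathlib`, ENGINE T1 (crux H413 = `stmt-HodgeConjecture-24833`); floor-1 preparation, count-neutral, under books rows #111 (S-d) ∕
#88 (ST-∞); brick «(V7)-FUBINI» (LEAD F0P3a-plan (g9) WORD T8-18 (B)(3) ∕ T8-19 «=», 2026-09-01; author B-p17 (g23); map = F0P3a-p06 (g10)
`CENSUS-ROAD-Sd-letters` 3ec10e9b §1∕§5 (B3)).  RULING T6-84 (V7): the limit-formula letters (C-bdry)∕(J-nc) are stated PER PLACE on `archLocal L N (diag α) w`;
this file is the bridge that lets them act on functions on the GLOBAL group.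

CURRENCY: `f ∈ C_c(G′_∞, E)` (★ p839258 ∕ p839464); `e := archPiEquivCM : G′_∞ ≃ₜ* Π_w G_w`; per-place Haar measures `ν_w` and the PRODUCT-MEASURE CONVENTION
`ν := e⁻¹_*(⊗_w ν_w)` on `G′_∞` (every Haar measure on `G′_∞` is a positive multiple of it); the split `Π_w G_w ≃ G_{w₀} × Π_{w ≠ w₀} G_w` is written through
Mathlib's `MeasurableEquiv.piEquivPiSubtypeProd (· = w₀)` and `MeasurableEquiv.piUnique` INLINE (no new definition).  No smoothness is claimed here (LEAD T8-19
ruled the smoothness currency (β): a separate cutoff lemma; the `C^∞` rider (h6) only on a named consumer).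

WHAT IS PROVED.
* §1 `archPiEquivCM_symm_mul_archDiagTorus_mul_inv` — conjugation by the torus point `t(z)` is componentwise along `e` (★ `archPiEquivCM_archDiagTorus`).
* §2 **(h0)** `isHaarMeasure_map_archPiEquivCM_symm_pi` (the convention is a Haar measure); **(h1)** `integral_comp_conj_archDiagTorus_map_symm_pi`:
  `∫_{G′_∞} f(g·t(z)·g⁻¹) dν = ∫_{Π_w G_w} f(e⁻¹(w ↦ y_w·diag(z_w)·y_w⁻¹)) d(⊗ ν_w)`.
* §3 **(h2)** `integral_comp_conj_archDiagTorus_eq_integral_integral` — FUBINI AT ONE PLACE `w₀` for `f ∈ C_c` and REGULAR `z` (integrability on the product from ★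
  global joint properness `hasCompactSupport_comp_conj_archDiagTorus`; Mathlib `measurePreserving_piEquivPiSubtypeProd`, `measurePreserving_piUnique`,
  `integral_prod`).
* §4 **(h3)** `continuous_hasCompactSupport_partialOrbital` — the PARTIAL ORBITAL INTEGRAL over the places `w ≠ w₀`,
  `f̃_{z′}(x′) = ∫_{Π_{w≠w₀} G_w} f(e⁻¹(x′, (b_w·diag(z_w)·b_w⁻¹)_{w≠w₀})) d(⊗_{w≠w₀} ν_w)`, is CONTINUOUS WITH COMPACT SUPPORT on `G_{w₀}` as soon as `z` is regular at
  the places `w ≠ w₀` — NOTHING is assumed at `w₀` (`z_{w₀}` may sit on a wall); ★ per-place joint properness at each `w ≠ w₀`, Mathlib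
  `continuousOn_integral_of_compact_support`; **(h4)** `integral_comp_conj_archDiagTorus_eq_integral_partial` — for regular `z`,
  `∫_{G′_∞} f(g·t(z)·g⁻¹) dν = ∫_{G_{w₀}} f̃_{z′}(x·diag(z_{w₀})·x⁻¹) dν_{w₀}(x)`: the global torus function IS the per-place torus function (the token shape of ★
  `continuousOn_integral_comp_conj_circleDiagonal`) of `f̃_{z′}`, so every per-place statement at `w₀` reads on the global function.
HONEST LABEL: HC_CM is proved only modulo the printed citations until rung 0 closes; this file is measure-theoretic bookkeeping and pays nothing by itself.

## References
* [BorelJacquet1979] A. Borel, H. Jacquet, *Automorphic forms and automorphic representations*, PSPM 33.1 (1979), §4.1 (`G_∞ = Π_v G(F_v)`, product measures).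
* [Rogawski1990] J. D. Rogawski, *Automorphic Representations of Unitary Groups in Three Variables*, Ann. of Math. Stud. 123 (1990), §1.7 p. 6 (measures),
  §8.2 p. 123 (per-place differentiation of orbital integrals), §8.3 p. 122 (orbital integrals on `T_reg`).
* [DeitmarEchterhoff2014] A. Deitmar, S. Echterhoff, *Principles of Harmonic Analysis*, 2nd ed. (2014), Lemma 9.3.3 (orbital integrals of `C_c` functions).
-/

set_option autoImplicit false

noncomputable section

open MeasureTheory Matrix NumberField NumberField.InfinitePlace
open scoped MatrixGroups

namespace Literature.NumberTheory.Automorphic.UnitaryGroup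

variable (L : Type) [Field L] [NumberField L] [IsCMField L] (N : ℕ) (α : Fin N → L)

/-! ## §1 Conjugation is componentwise along `G′_∞ ≃ₜ* Π_w G_w` -/

/-- **Componentwise conjugation**: `e⁻¹(y) · t(z) · e⁻¹(y)⁻¹ = e⁻¹ (w ↦ y_w · diag(z_w) · y_w⁻¹)` for `e = archPiEquivCM` (★ `archPiEquivCM_archDiagTorus`).
[cite: BorelJacquet1979, §4.1] [cite: Rogawski1990, §4.9 p. 54] -/
theorem archPiEquivCM_symm_mul_archDiagTorus_mul_inv (y : ∀ w : {w : InfinitePlace L // IsComplex w}, archLocal L N (Matrix.diagonal α) w)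
    (z : {w : InfinitePlace L // IsComplex w} → Fin N → Circle) :
    (archPiEquivCM N L (Matrix.diagonal α)).symm y * archDiagTorus L N α z * ((archPiEquivCM N L (Matrix.diagonal α)).symm y)⁻¹ =
      (archPiEquivCM N L (Matrix.diagonal α)).symm
        (fun w => y w * ⟨circleDiagonal N (z w), circleDiagonal_mem_archLocal_diagonal L N α w (z w)⟩ * (y w)⁻¹) := by
  apply (archPiEquivCM N L (Matrix.diagonal α)).injective
  rw [map_mul, map_mul, map_inv, ContinuousMulEquiv.apply_symm_apply, ContinuousMulEquiv.apply_symm_apply]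
  funext w
  rw [Pi.mul_apply, Pi.mul_apply, Pi.inv_apply, archPiEquivCM_archDiagTorus]

/-! ## §2 The product-measure convention and the change of variables -/

variable [MeasurableSpace (arch (↥(maximalRealSubfield L)) L (IsCMField.complexConj L) N (Matrix.diagonal α))]
  [BorelSpace (arch (↥(maximalRealSubfield L)) L (IsCMField.complexConj L) N (Matrix.diagonal α))]
  [∀ w : {w : InfinitePlace L // IsComplex w}, MeasurableSpace (archLocal L N (Matrix.diagonal α) w)]
  [∀ w : {w : InfinitePlace L // IsComplex w}, BorelSpace (archLocal L N (Matrix.diagonal α) w)]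
  [∀ w : {w : InfinitePlace L // IsComplex w}, SecondCountableTopology (archLocal L N (Matrix.diagonal α) w)]

open scoped Classical in
/-- **(h1) THE TORUS ORBITAL INTEGRAL OVER THE PRODUCT MEASURE**: with the product-measure convention `ν = e⁻¹_*(⊗_w ν_w)` on `G′_∞`,
`∫_{G′_∞} f(g·t(z)·g⁻¹) dν = ∫_{Π_w G_w} f(e⁻¹(w ↦ y_w·diag(z_w)·y_w⁻¹)) d(⊗_w ν_w)` — every integrand on `G′_∞` becomes a function of the per-place conjugates.
[cite: BorelJacquet1979, §4.1] [cite: Rogawski1990, §8.3 p. 122] -/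
theorem integral_comp_conj_archDiagTorus_map_symm_pi {E : Type*} [NormedAddCommGroup E] [NormedSpace ℝ E]
    (νw : ∀ w : {w : InfinitePlace L // IsComplex w}, Measure (archLocal L N (Matrix.diagonal α) w)) [∀ w, SigmaFinite (νw w)]
    (f : arch (↥(maximalRealSubfield L)) L (IsCMField.complexConj L) N (Matrix.diagonal α) → E)
    (z : {w : InfinitePlace L // IsComplex w} → Fin N → Circle) :
    ∫ g, f (g * archDiagTorus L N α z * g⁻¹) ∂((Measure.pi νw).map (archPiEquivCM N L (Matrix.diagonal α)).symm) =
      ∫ y, f ((archPiEquivCM N L (Matrix.diagonal α)).symm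
        (fun w => y w * ⟨circleDiagonal N (z w), circleDiagonal_mem_archLocal_diagonal L N α w (z w)⟩ * (y w)⁻¹)) ∂(Measure.pi νw) := by
  set φ : (∀ w : {w : InfinitePlace L // IsComplex w}, archLocal L N (Matrix.diagonal α) w) ≃ᵐ
      arch (↥(maximalRealSubfield L)) L (IsCMField.complexConj L) N (Matrix.diagonal α) :=
    (archPiEquivCM N L (Matrix.diagonal α)).symm.toHomeomorph.toMeasurableEquiv with hφ
  have hφe : (⇑φ : (∀ w, archLocal L N (Matrix.diagonal α) w) → _) = (archPiEquivCM N L (Matrix.diagonal α)).symm := rfl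
  rw [← hφe, integral_map_equiv φ]
  simp only [hφe, archPiEquivCM_symm_mul_archDiagTorus_mul_inv]

variable [∀ w : {w : InfinitePlace L // IsComplex w}, LocallyCompactSpace (archLocal L N (Matrix.diagonal α) w)]

open scoped Classical in
/-- **(h0) THE PRODUCT-MEASURE CONVENTION IS A HAAR MEASURE**: for per-place Haar measures `ν_w` on `G_w`, the transported product `e⁻¹_*(⊗_w ν_w)` is a
Haar measure on `G′_∞ = U(diag α)(L⁺ ⊗ ℝ)` (Mathlib `Measure.pi.isHaarMeasure` + `ContinuousMulEquiv.isHaarMeasure_map`); by uniqueness every Haar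
measure on `G′_∞` is a positive multiple of it — the honest content of «`dg = ∏_w dg_w`». [cite: BorelJacquet1979, §4.1] [cite: Rogawski1990, §1.7 p. 6] -/
theorem isHaarMeasure_map_archPiEquivCM_symm_pi
    (νw : ∀ w : {w : InfinitePlace L // IsComplex w}, Measure (archLocal L N (Matrix.diagonal α) w)) [∀ w, (νw w).IsHaarMeasure] :
    ((Measure.pi νw).map (archPiEquivCM N L (Matrix.diagonal α)).symm).IsHaarMeasure :=
  ContinuousMulEquiv.isHaarMeasure_map (Measure.pi νw) (archPiEquivCM N L (Matrix.diagonal α)).symm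

/-! ## §3 Fubini: split off one place `w₀` -/

open scoped Classical in
/-- **(h2) FUBINI AT ONE PLACE `w₀`.**  For `f ∈ C_c(G′_∞, E)` and a REGULAR torus point `t(z)` (every `z_w` injective), the torus orbital integral over
the product measure is an iterated integral: first over the components `y′ = (y_w)_{w ≠ w₀}` at the other places, then over `y_{w₀} ∈ G_{w₀}` — with the
assembled family `y = (y_{w₀}, y′)` written through Mathlib's `piEquivPiSubtypeProd (· = w₀)` and `piUnique` (no new definition).  Integrability on the
product comes from ★ global joint properness (`hasCompactSupport_comp_conj_archDiagTorus`). [cite: BorelJacquet1979, §4.1] [cite: Rogawski1990, §8.3 p. 122] -/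
theorem integral_comp_conj_archDiagTorus_eq_integral_integral {E : Type*} [NormedAddCommGroup E] [NormedSpace ℝ E]
    (νw : ∀ w : {w : InfinitePlace L // IsComplex w}, Measure (archLocal L N (Matrix.diagonal α) w)) [∀ w, (νw w).IsHaarMeasure]
    (hα : ∀ i, α i ≠ 0) (w₀ : {w : InfinitePlace L // IsComplex w})
    (f : arch (↥(maximalRealSubfield L)) L (IsCMField.complexConj L) N (Matrix.diagonal α) → E) (hf : Continuous f) (hfc : HasCompactSupport f)
    {z : {w : InfinitePlace L // IsComplex w} → Fin N → Circle} (hz : ∀ w, Function.Injective (z w)) :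
    ∫ g, f (g * archDiagTorus L N α z * g⁻¹) ∂((Measure.pi νw).map (archPiEquivCM N L (Matrix.diagonal α)).symm) =
      ∫ x : archLocal L N (Matrix.diagonal α) w₀, (∫ b : (∀ w' : {w : {w : InfinitePlace L // IsComplex w} // ¬ w = w₀}, archLocal L N (Matrix.diagonal α) w'.1),
        f ((archPiEquivCM N L (Matrix.diagonal α)).symm (fun w =>
          (MeasurableEquiv.piEquivPiSubtypeProd (fun w : {w : InfinitePlace L // IsComplex w} => ↥(archLocal L N (Matrix.diagonal α) w)) (· = w₀)).symm
              ((MeasurableEquiv.piUnique fun i : {w : {w : InfinitePlace L // IsComplex w} // w = w₀} => ↥(archLocal L N (Matrix.diagonal α) i.1)).symm x, b) w *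
            ⟨circleDiagonal N (z w), circleDiagonal_mem_archLocal_diagonal L N α w (z w)⟩ *
          ((MeasurableEquiv.piEquivPiSubtypeProd (fun w : {w : InfinitePlace L // IsComplex w} => ↥(archLocal L N (Matrix.diagonal α) w)) (· = w₀)).symm
              ((MeasurableEquiv.piUnique fun i : {w : {w : InfinitePlace L // IsComplex w} // w = w₀} => ↥(archLocal L N (Matrix.diagonal α) i.1)).symm x, b) w)⁻¹))
        ∂(Measure.pi fun w' : {w : {w : InfinitePlace L // IsComplex w} // ¬ w = w₀} => νw w'.1)) ∂(νw w₀) := by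
  -- the integrand on `Π_w G_w`
  set F : (∀ w : {w : InfinitePlace L // IsComplex w}, archLocal L N (Matrix.diagonal α) w) → E :=
    fun y => f ((archPiEquivCM N L (Matrix.diagonal α)).symm
      (fun w => y w * ⟨circleDiagonal N (z w), circleDiagonal_mem_archLocal_diagonal L N α w (z w)⟩ * (y w)⁻¹)) with hF
  -- step 1: change of variables along `e`
  rw [integral_comp_conj_archDiagTorus_map_symm_pi L N α νw f z]
  -- `F` is continuous with compact support on `Π_w G_w`, hence integrable for the product Haar measure
  have hFeq : F = (fun g => f (g * archDiagTorus L N α z * g⁻¹)) ∘ (archPiEquivCM N L (Matrix.diagonal α)).symm := by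
    funext y
    rw [Function.comp_apply, archPiEquivCM_symm_mul_archDiagTorus_mul_inv]
  have hFc : Continuous F := by
    rw [hFeq]
    exact (hf.comp ((continuous_id.mul continuous_const).mul continuous_inv)).comp (archPiEquivCM N L (Matrix.diagonal α)).symm.continuous
  have hFs : HasCompactSupport F := by
    rw [hFeq]
    exact (hasCompactSupport_comp_conj_archDiagTorus L N α hα hz f hfc).comp_homeomorph
      (archPiEquivCM N L (Matrix.diagonal α)).symm.toHomeomorph
  have hFi : Integrable F (Measure.pi νw) := hFc.integrable_of_hasCompactSupport hFs
  -- step 2: split `Π_w G_w ≃ (Π_{w = w₀} G_w) × (Π_{w ≠ w₀} G_w)` (measure preserving) and apply Fubini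
  have hψ' := measurePreserving_piEquivPiSubtypeProd (fun w => νw w) (· = w₀)
  have h2 := (hψ'.symm.integral_comp' F).symm
  have hFi' : Integrable (fun q => F ((MeasurableEquiv.piEquivPiSubtypeProd
      (fun w : {w : InfinitePlace L // IsComplex w} => ↥(archLocal L N (Matrix.diagonal α) w)) (· = w₀)).symm q)) _ :=
    (hψ'.symm.integrable_comp_emb (MeasurableEquiv.measurableEmbedding _)).mpr hFi
  rw [show (∫ y, f ((archPiEquivCM N L (Matrix.diagonal α)).symm
      (fun w => y w * ⟨circleDiagonal N (z w), circleDiagonal_mem_archLocal_diagonal L N α w (z w)⟩ * (y w)⁻¹)) ∂(Measure.pi νw)) =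
      ∫ y, F y ∂(Measure.pi νw) from rfl, h2, integral_prod _ hFi']
  -- step 3: the first factor `Π_{w = w₀} G_w ≃ G_{w₀}` (`piUnique`)
  have hu' : MeasurePreserving (MeasurableEquiv.piUnique fun i : {w : {w : InfinitePlace L // IsComplex w} // w = w₀} => ↥(archLocal L N (Matrix.diagonal α) i.1))
      (@Measure.pi {w : {w : InfinitePlace L // IsComplex w} // w = w₀} (fun i => ↥(archLocal L N (Matrix.diagonal α) i.1))
        (Subtype.fintype fun x => x = w₀) (fun i => inferInstance) (fun i => νw i.1)) (νw w₀) := by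
    convert measurePreserving_piUnique (fun i : {w : {w : InfinitePlace L // IsComplex w} // w = w₀} => νw i.1) <;>
      exact ((default : {w : {w : InfinitePlace L // IsComplex w} // w = w₀}).2).symm
  rw [← hu'.symm.integral_comp']
  rfl

/-! ## §4 The partial orbital integral over the places `w ≠ w₀` -/

/-- The inverse of Mathlib's `piEquivPiSubtypeProd`, read componentwise (definitional). [folklore] -/
private theorem piEquivPiSubtypeProd_symm_apply_eq {ι : Type*} (π : ι → Type*) [∀ i, MeasurableSpace (π i)] (p : ι → Prop)
    [DecidablePred p] (a : ∀ i : Subtype p, π i) (b : ∀ i : {i // ¬ p i}, π i) (i : ι) :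
    (MeasurableEquiv.piEquivPiSubtypeProd π p).symm (a, b) i = if h : p i then a ⟨i, h⟩ else b ⟨i, h⟩ := rfl

/-- The inverse of Mathlib's `piUnique` over the singleton `{w ∣ w = w₀}`, read at `w₀` (definitional up to `uniqueElim_default`). [folklore] -/
private theorem piUnique_symm_apply_self {ι : Type*} (π : ι → Type*) [∀ i, MeasurableSpace (π i)] (i₀ : ι) (x : π i₀) (h : i₀ = i₀) :
    (MeasurableEquiv.piUnique fun i : {i // i = i₀} => π i.1).symm x ⟨i₀, h⟩ = x :=
  uniqueElim_default (α := fun i : {i // i = i₀} => π i.1) x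

omit [MeasurableSpace (arch (↥(maximalRealSubfield L)) L (IsCMField.complexConj L) N (Matrix.diagonal α))]
  [BorelSpace (arch (↥(maximalRealSubfield L)) L (IsCMField.complexConj L) N (Matrix.diagonal α))]
  [∀ w : {w : InfinitePlace L // IsComplex w}, BorelSpace (archLocal L N (Matrix.diagonal α) w)]
  [∀ w : {w : InfinitePlace L // IsComplex w}, SecondCountableTopology (archLocal L N (Matrix.diagonal α) w)]
  [∀ w : {w : InfinitePlace L // IsComplex w}, LocallyCompactSpace (archLocal L N (Matrix.diagonal α) w)] [NumberField L] [IsCMField L] in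
open scoped Classical in
/-- **REASSEMBLY**: conjugating the assembled family `(x, b)` componentwise by the torus point `(diag z_w)_w` is the assembled family of the conjugated
pieces `(x·diag(z_{w₀})·x⁻¹, (b_{w′}·diag(z_{w′})·b_{w′}⁻¹)_{w′ ≠ w₀})`. [folklore] -/
private theorem conj_assemble_eq (w₀ : {w : InfinitePlace L // IsComplex w}) (x : archLocal L N (Matrix.diagonal α) w₀)
    (b : ∀ w' : {w : {w : InfinitePlace L // IsComplex w} // ¬ w = w₀}, archLocal L N (Matrix.diagonal α) w'.1)
    (d : ∀ w : {w : InfinitePlace L // IsComplex w}, archLocal L N (Matrix.diagonal α) w) :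
    (fun w => (MeasurableEquiv.piEquivPiSubtypeProd (fun w : {w : InfinitePlace L // IsComplex w} => ↥(archLocal L N (Matrix.diagonal α) w)) (· = w₀)).symm
        ((MeasurableEquiv.piUnique fun i : {w : {w : InfinitePlace L // IsComplex w} // w = w₀} => ↥(archLocal L N (Matrix.diagonal α) i.1)).symm x, b) w *
        d w *
      ((MeasurableEquiv.piEquivPiSubtypeProd (fun w : {w : InfinitePlace L // IsComplex w} => ↥(archLocal L N (Matrix.diagonal α) w)) (· = w₀)).symm
        ((MeasurableEquiv.piUnique fun i : {w : {w : InfinitePlace L // IsComplex w} // w = w₀} => ↥(archLocal L N (Matrix.diagonal α) i.1)).symm x, b) w)⁻¹) =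
    (MeasurableEquiv.piEquivPiSubtypeProd (fun w : {w : InfinitePlace L // IsComplex w} => ↥(archLocal L N (Matrix.diagonal α) w)) (· = w₀)).symm
      ((MeasurableEquiv.piUnique fun i : {w : {w : InfinitePlace L // IsComplex w} // w = w₀} => ↥(archLocal L N (Matrix.diagonal α) i.1)).symm
        (x * d w₀ * x⁻¹), fun w' => b w' * d w'.1 * (b w')⁻¹) := by
  funext w
  rw [piEquivPiSubtypeProd_symm_apply_eq, piEquivPiSubtypeProd_symm_apply_eq]
  by_cases h : w = w₀
  · subst h
    rw [dif_pos rfl, dif_pos rfl]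
    erw [piUnique_symm_apply_self (fun j : {w : InfinitePlace L // IsComplex w} => ↥(archLocal L N (Matrix.diagonal α) j)) w x,
      piUnique_symm_apply_self (fun j : {w : InfinitePlace L // IsComplex w} => ↥(archLocal L N (Matrix.diagonal α) j)) w (x * d w * x⁻¹)]
  · rw [dif_neg h, dif_neg h]

open scoped Classical in
/-- **(h4) THE GLOBAL TORUS FUNCTION IS THE PER-PLACE TORUS FUNCTION OF THE PARTIAL ORBITAL INTEGRAL.**  For `f ∈ C_c(G′_∞, E)`, a place `w₀` and a regular
torus point `t(z)`: `∫_{G′_∞} f(g·t(z)·g⁻¹) dν = ∫_{G_{w₀}} f̃_{z′}(x·diag(z_{w₀})·x⁻¹) dν_{w₀}(x)`, where `f̃_{z′}(x′) = ∫_{Π_{w≠w₀} G_w} f(e⁻¹(x′, (b_w·diag(z_w)·b_w⁻¹)_{w ≠ w₀})) d(⊗_{w≠w₀} ν_w)`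
is the PARTIAL ORBITAL INTEGRAL over the other places (the lambda below) — token for token the per-place torus function of ★ `continuousOn_integral_comp_conj_circleDiagonal`
applied to `f̃_{z′}`, so every per-place statement at `w₀` (regular continuity ★, compact walls ★, the limit-formula letters) reads on the global function.
[cite: BorelJacquet1979, §4.1] [cite: Rogawski1990, §8.2 p. 123; §8.3 p. 122] -/
theorem integral_comp_conj_archDiagTorus_eq_integral_partial {E : Type*} [NormedAddCommGroup E] [NormedSpace ℝ E]
    (νw : ∀ w : {w : InfinitePlace L // IsComplex w}, Measure (archLocal L N (Matrix.diagonal α) w)) [∀ w, (νw w).IsHaarMeasure]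
    (hα : ∀ i, α i ≠ 0) (w₀ : {w : InfinitePlace L // IsComplex w})
    (f : arch (↥(maximalRealSubfield L)) L (IsCMField.complexConj L) N (Matrix.diagonal α) → E) (hf : Continuous f) (hfc : HasCompactSupport f)
    {z : {w : InfinitePlace L // IsComplex w} → Fin N → Circle} (hz : ∀ w, Function.Injective (z w)) :
    ∫ g, f (g * archDiagTorus L N α z * g⁻¹) ∂((Measure.pi νw).map (archPiEquivCM N L (Matrix.diagonal α)).symm) =
      ∫ x : archLocal L N (Matrix.diagonal α) w₀,
        (fun x' : archLocal L N (Matrix.diagonal α) w₀ =>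
          ∫ b : (∀ w' : {w : {w : InfinitePlace L // IsComplex w} // ¬ w = w₀}, archLocal L N (Matrix.diagonal α) w'.1),
            f ((archPiEquivCM N L (Matrix.diagonal α)).symm
              ((MeasurableEquiv.piEquivPiSubtypeProd (fun w : {w : InfinitePlace L // IsComplex w} => ↥(archLocal L N (Matrix.diagonal α) w)) (· = w₀)).symm
                ((MeasurableEquiv.piUnique fun i : {w : {w : InfinitePlace L // IsComplex w} // w = w₀} => ↥(archLocal L N (Matrix.diagonal α) i.1)).symm x',
                  fun w' => b w' * ⟨circleDiagonal N (z w'.1), circleDiagonal_mem_archLocal_diagonal L N α w'.1 (z w'.1)⟩ * (b w')⁻¹)))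
            ∂(Measure.pi fun w' : {w : {w : InfinitePlace L // IsComplex w} // ¬ w = w₀} => νw w'.1))
        (x * ⟨circleDiagonal N (z w₀), circleDiagonal_mem_archLocal_diagonal L N α w₀ (z w₀)⟩ * x⁻¹) ∂(νw w₀) := by
  rw [integral_comp_conj_archDiagTorus_eq_integral_integral L N α νw hα w₀ f hf hfc hz]
  refine integral_congr_ae (Filter.Eventually.of_forall fun x => ?_)
  refine integral_congr_ae (Filter.Eventually.of_forall fun b => ?_)
  simp only []
  rw [conj_assemble_eq L N α w₀ x b (fun w => ⟨circleDiagonal N (z w), circleDiagonal_mem_archLocal_diagonal L N α w (z w)⟩)]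

omit [MeasurableSpace (arch (↥(maximalRealSubfield L)) L (IsCMField.complexConj L) N (Matrix.diagonal α))]
  [BorelSpace (arch (↥(maximalRealSubfield L)) L (IsCMField.complexConj L) N (Matrix.diagonal α))] in
open scoped Classical in
/-- **(h3) THE PARTIAL ORBITAL INTEGRAL IS CONTINUOUS WITH COMPACT SUPPORT ON `G_{w₀}`.**  For `f ∈ C_c(G′_∞, E)` and torus coordinates `z_{w′}` that are
REGULAR AT THE PLACES `w′ ≠ w₀` (nothing is assumed at `w₀` — the point of the construction: `z_{w₀}` may sit on a wall), the partial orbital integral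
`f̃_{z′}(x′) = ∫_{Π_{w≠w₀} G_w} f(e⁻¹(x′, (b_w·diag(z_w)·b_w⁻¹)_{w≠w₀})) d(⊗_{w≠w₀} ν_w)` is continuous and compactly supported on `G_{w₀}`: for every `x′` the
`b`-integrand is supported in ONE compact set (★ per-place joint properness `isCompact_setOf_exists_conj_circleDiagonal_mem` at each `w′ ≠ w₀`), and
`f̃_{z′}(x′) = 0` unless `x′` lies in the (compact) `w₀`-projection of the support of `f`. [cite: BorelJacquet1979, §4.1] [cite: Rogawski1990, §8.3 p. 122]
[cite: DeitmarEchterhoff2014, Lemma 9.3.3] -/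
theorem continuous_hasCompactSupport_partialOrbital {E : Type*} [NormedAddCommGroup E] [NormedSpace ℝ E]
    (νw : ∀ w : {w : InfinitePlace L // IsComplex w}, Measure (archLocal L N (Matrix.diagonal α) w)) [∀ w, (νw w).IsHaarMeasure]
    (hα : ∀ i, α i ≠ 0) (w₀ : {w : InfinitePlace L // IsComplex w})
    (f : arch (↥(maximalRealSubfield L)) L (IsCMField.complexConj L) N (Matrix.diagonal α) → E) (hf : Continuous f) (hfc : HasCompactSupport f)
    {z : {w : InfinitePlace L // IsComplex w} → Fin N → Circle} (hz : ∀ w, w ≠ w₀ → Function.Injective (z w)) :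
    Continuous (fun x' : archLocal L N (Matrix.diagonal α) w₀ =>
          ∫ b : (∀ w' : {w : {w : InfinitePlace L // IsComplex w} // ¬ w = w₀}, archLocal L N (Matrix.diagonal α) w'.1),
            f ((archPiEquivCM N L (Matrix.diagonal α)).symm
              ((MeasurableEquiv.piEquivPiSubtypeProd (fun w : {w : InfinitePlace L // IsComplex w} => ↥(archLocal L N (Matrix.diagonal α) w)) (· = w₀)).symm
                ((MeasurableEquiv.piUnique fun i : {w : {w : InfinitePlace L // IsComplex w} // w = w₀} => ↥(archLocal L N (Matrix.diagonal α) i.1)).symm x',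
                  fun w' => b w' * ⟨circleDiagonal N (z w'.1), circleDiagonal_mem_archLocal_diagonal L N α w'.1 (z w'.1)⟩ * (b w')⁻¹)))
            ∂(Measure.pi fun w' : {w : {w : InfinitePlace L // IsComplex w} // ¬ w = w₀} => νw w'.1)) ∧
      HasCompactSupport (fun x' : archLocal L N (Matrix.diagonal α) w₀ =>
          ∫ b : (∀ w' : {w : {w : InfinitePlace L // IsComplex w} // ¬ w = w₀}, archLocal L N (Matrix.diagonal α) w'.1),
            f ((archPiEquivCM N L (Matrix.diagonal α)).symm
              ((MeasurableEquiv.piEquivPiSubtypeProd (fun w : {w : InfinitePlace L // IsComplex w} => ↥(archLocal L N (Matrix.diagonal α) w)) (· = w₀)).symm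
                ((MeasurableEquiv.piUnique fun i : {w : {w : InfinitePlace L // IsComplex w} // w = w₀} => ↥(archLocal L N (Matrix.diagonal α) i.1)).symm x',
                  fun w' => b w' * ⟨circleDiagonal N (z w'.1), circleDiagonal_mem_archLocal_diagonal L N α w'.1 (z w'.1)⟩ * (b w')⁻¹)))
            ∂(Measure.pi fun w' : {w : {w : InfinitePlace L // IsComplex w} // ¬ w = w₀} => νw w'.1)) := by
  -- abbreviations (as plain `have`-free lets via `set` on my own terms only)
  set e := archPiEquivCM N L (Matrix.diagonal α) with he
  set d : ∀ w : {w : InfinitePlace L // IsComplex w}, archLocal L N (Matrix.diagonal α) w :=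
    fun w => ⟨circleDiagonal N (z w), circleDiagonal_mem_archLocal_diagonal L N α w (z w)⟩ with hd
  set A : archLocal L N (Matrix.diagonal α) w₀ → (∀ w' : {w : {w : InfinitePlace L // IsComplex w} // ¬ w = w₀}, archLocal L N (Matrix.diagonal α) w'.1) →
      (∀ w : {w : InfinitePlace L // IsComplex w}, archLocal L N (Matrix.diagonal α) w) :=
    fun x' b => (MeasurableEquiv.piEquivPiSubtypeProd (fun w : {w : InfinitePlace L // IsComplex w} => ↥(archLocal L N (Matrix.diagonal α) w)) (· = w₀)).symm
      ((MeasurableEquiv.piUnique fun i : {w : {w : InfinitePlace L // IsComplex w} // w = w₀} => ↥(archLocal L N (Matrix.diagonal α) i.1)).symm x',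
        fun w' => b w' * d w'.1 * (b w')⁻¹) with hA
  -- componentwise reading of the assembled family
  have hA₀ : ∀ x' b, A x' b w₀ = x' := fun x' b => by
    rw [hA]; dsimp only
    rw [piEquivPiSubtypeProd_symm_apply_eq, dif_pos rfl]
    exact piUnique_symm_apply_self (fun j : {w : InfinitePlace L // IsComplex w} => ↥(archLocal L N (Matrix.diagonal α) j)) w₀ x' rfl
  have hA' : ∀ x' b (w' : {w : {w : InfinitePlace L // IsComplex w} // ¬ w = w₀}), A x' b w'.1 = b w' * d w'.1 * (b w')⁻¹ := fun x' b w' => by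
    rw [hA]; dsimp only
    rw [piEquivPiSubtypeProd_symm_apply_eq, dif_neg w'.2]
  -- joint continuity of `(x', b) ↦ A x' b`
  have hAc : Continuous fun q : archLocal L N (Matrix.diagonal α) w₀ ×
      (∀ w' : {w : {w : InfinitePlace L // IsComplex w} // ¬ w = w₀}, archLocal L N (Matrix.diagonal α) w'.1) => A q.1 q.2 := by
    refine continuous_pi fun w => ?_
    by_cases h : w = w₀
    · subst h
      have : (fun q : archLocal L N (Matrix.diagonal α) w ×
          (∀ w' : {w' : {w : InfinitePlace L // IsComplex w} // ¬ w' = w}, archLocal L N (Matrix.diagonal α) w'.1) => A q.1 q.2 w) = fun q => q.1 :=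
        funext fun q => hA₀ q.1 q.2
      rw [this]; exact continuous_fst
    · have : (fun q : archLocal L N (Matrix.diagonal α) w₀ ×
          (∀ w' : {w : {w : InfinitePlace L // IsComplex w} // ¬ w = w₀}, archLocal L N (Matrix.diagonal α) w'.1) => A q.1 q.2 w) =
          fun q => q.2 ⟨w, h⟩ * d w * (q.2 ⟨w, h⟩)⁻¹ := funext fun q => hA' q.1 q.2 ⟨w, h⟩
      rw [this]
      have h1 : Continuous fun q : archLocal L N (Matrix.diagonal α) w₀ ×
          (∀ w' : {w : {w : InfinitePlace L // IsComplex w} // ¬ w = w₀}, archLocal L N (Matrix.diagonal α) w'.1) => q.2 ⟨w, h⟩ :=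
        (continuous_apply (⟨w, h⟩ : {w : {w : InfinitePlace L // IsComplex w} // ¬ w = w₀})).comp continuous_snd
      exact (h1.mul continuous_const).mul h1.inv
  have hΦc : Continuous fun q : archLocal L N (Matrix.diagonal α) w₀ ×
      (∀ w' : {w : {w : InfinitePlace L // IsComplex w} // ¬ w = w₀}, archLocal L N (Matrix.diagonal α) w'.1) => f (e.symm (A q.1 q.2)) := by
    have h2 : Continuous fun q : archLocal L N (Matrix.diagonal α) w₀ ×
        (∀ w' : {w : {w : InfinitePlace L // IsComplex w} // ¬ w = w₀}, archLocal L N (Matrix.diagonal α) w'.1) => e.symm (A q.1 q.2) :=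
      e.symm.continuous.comp hAc
    exact hf.comp h2
  -- the per-place compact sets: `w`-projections of the support, and the joint-properness sets at `w′ ≠ w₀`
  have hCw : ∀ w : {w : InfinitePlace L // IsComplex w}, IsCompact ((fun g => e g w) '' tsupport f) := fun w =>
    hfc.image ((continuous_apply w).comp e.continuous)
  have hSw : ∀ w' : {w : {w : InfinitePlace L // IsComplex w} // ¬ w = w₀}, IsCompact {g : archLocal L N (Matrix.diagonal α) w'.1 |
      ∃ zz ∈ ({z w'.1} : Set (Fin N → Circle)), g * ⟨circleDiagonal N zz, circleDiagonal_mem_archLocal_diagonal L N α w'.1 zz⟩ * g⁻¹ ∈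
        (fun g => e g w'.1) '' tsupport f} := fun w' =>
    isCompact_setOf_exists_conj_circleDiagonal_mem L N α w'.1 hα isCompact_singleton (by
      rintro _ rfl; exact hz w'.1 w'.2) (hCw w'.1)
  have hK : IsCompact (Set.univ.pi fun w' : {w : {w : InfinitePlace L // IsComplex w} // ¬ w = w₀} => {g : archLocal L N (Matrix.diagonal α) w'.1 |
      ∃ zz ∈ ({z w'.1} : Set (Fin N → Circle)), g * ⟨circleDiagonal N zz, circleDiagonal_mem_archLocal_diagonal L N α w'.1 zz⟩ * g⁻¹ ∈
        (fun g => e g w'.1) '' tsupport f}) := isCompact_univ_pi hSw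
  -- support control: if the integrand is non-zero then `x′ ∈ C_{w₀}` and `b ∈ K`
  have hsupp : ∀ x' b, f (e.symm (A x' b)) ≠ 0 →
      x' ∈ (fun g => e g w₀) '' tsupport f ∧ b ∈ Set.univ.pi fun w' : {w : {w : InfinitePlace L // IsComplex w} // ¬ w = w₀} =>
        {g : archLocal L N (Matrix.diagonal α) w'.1 | ∃ zz ∈ ({z w'.1} : Set (Fin N → Circle)),
          g * ⟨circleDiagonal N zz, circleDiagonal_mem_archLocal_diagonal L N α w'.1 zz⟩ * g⁻¹ ∈ (fun g => e g w'.1) '' tsupport f} := by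
    intro x' b hne
    have hmem : e.symm (A x' b) ∈ tsupport f := subset_tsupport _ (Function.mem_support.mpr hne)
    have himg : ∀ w, A x' b w ∈ (fun g => e g w) '' tsupport f := fun w =>
      ⟨e.symm (A x' b), hmem, by simp only [ContinuousMulEquiv.apply_symm_apply]⟩
    refine ⟨?_, fun w' _ => ⟨z w'.1, rfl, ?_⟩⟩
    · rw [← hA₀ x' b]; exact himg w₀
    · rw [← hA' x' b w']; exact himg w'.1
  refine ⟨?_, ?_⟩
  · -- continuity: uniformly compactly supported continuous parametric integral
    rw [← continuousOn_univ]
    refine continuousOn_integral_of_compact_support hK (hΦc.continuousOn) ?_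
    intro x' b _ hb
    by_contra hne
    exact hb (hsupp x' b hne).2
  · -- compact support inside the `w₀`-projection of the support of `f`
    refine HasCompactSupport.intro (hCw w₀) fun x' hx' => ?_
    refine integral_eq_zero_of_ae (Filter.Eventually.of_forall fun b => ?_)
    by_contra hne
    exact hx' (hsupp x' b hne).1

end Literature.NumberTheory.Automorphic.UnitaryGroup
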